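import Summits.CriticalPhenomena.PercolationContinuityZ3.Theorems.PercNearOneGluingNoHeavyLowerTailThreePointProductFormFibreTwoPortLocality
import HarnessLib

/-!
# The product form `#bad² ≤ #P1·#P2` in the fibre language: THE TWO-TERMINAL SUBSTITUTION THEOREM, POINTWISE PART
# (Sahi programme, prover prim-sahi-p2 gen 55)

Support file (`--supports stmt-CriticalPhenomena-4575`, helper); second part of the formalisation of reduction R4 (memo
`run/shared/lean/prim/prim-sahi/FROM-prim-sahi-p2-gen55-REDUCTIONS.md` §0(0), §3), after `…FibreTwoPortLocality`.  Standard axioms, no sorries, no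
named facts, no definitions: every auxiliary object is an arbitrary function together with its defining clauses (hypotheses `hzn…`, `hRr`, `hFl…`,
`hFn…`), discharged by `rfl`/`simp` at any concrete instance.

SETTING (as in `…FibreTwoPortLocality`): interior `Nv`, ports `p, q ∉ Nv`, label classes `inN` / rest; terminals `a, s, c ∉ Nv` (the terminal-free
network of R4).  `zn z`, `zr z` = network / rest part of `z`;  `Rr z e u v` = connection in the rest part with the virtual edge `pq` available iff
`e = true` (used at most once);  `Fl z e` = the REST FLAT: on rest labels, complement `z` exactly on the labels touching the `Rr z e`-cluster of the apex
`a` (closed on the network);  `Fn z πp πq` = the NETWORK FLIP by the port pattern `(πp, πq)`: on network labels, complement `z` exactly on the labels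
touching the `zn z`-cluster of `p` (if `πp`) or of `q` (if `πq`) (closed on the rest).
* **`flat_eq_parts`** [this work] — if `e, πp, πq` are the true values (`R (zn z) p q ↔ e`, `Rr z e a p ↔ πp`, `Rr z e a q ↔ πq`) then the flat
  `♭ₐz = clusterFlip ends a z̄` has network part `Fn z πp πq` and rest part `Fl z e`.
* **`bad_iff_restBad`** [this work] — THE MASTER POINTWISE LEMMA: with moreover `R (Fn z πp πq) p q ↔ e'`,
  `bad(z) ↔ BadR(z; e, e')` where `BadR(z; e, e') :≡ ¬Rr z e a s ∧ ¬Rr z e a c ∧ ¬Rr z e s c ∧ (s ↔ c in Fl z e with the virtual edge iff e')` —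
  the bad event of `H` is the bad event of the REST with the network replaced by a virtual edge whose state is `e` before the flat and `e'` after.
  Likewise `sa_iff_rest` for `P1 = {a ↔ s, a ↮ c}` (only `e` matters).
The counting half (independence, the interface values `ν(e, π, e′) ∈ {Cn, Dn, A, Cn − A, Dn − Cn + A, 0}` from `…FibreTwoTerminal` /
`…FibreTwoClusterFlip`, and the regrouping into `A·[contract] + (Cn−A)·[edge] + (Dn−Cn+A)·[delete]`) is the next file.
[folklore] (walks through a separator); [cite: Gladkov2024, Conjecture 10.1 (p. 18), arXiv:2408.08457] for CONJECTURE (P).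
-/

namespace Summit.CriticalPhenomena.PercolationContinuityZ3.Theorems.ProductFormFibre

open Finset Literature.Probability.Percolation
open Summit.CriticalPhenomena.PercolationContinuityZ3.Theorems.ThreePointCPIClusterSwap
  (CReach QTouch clusterFlip clusterFlip_of_qtouch clusterFlip_of_not_qtouch)

variable {V α : Type*}

section Substitution

variable (ends : α → Sym2 V) (p q a : V) (Nv : Set V) (inN : α → Prop)
  (hN1 : ∀ l, inN l → ∀ v ∈ ends l, v ∈ Nv ∨ v = p ∨ v = q) (hN2 : ∀ l, ¬ inN l → ∀ v ∈ ends l, v ∉ Nv)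
  (hp : p ∉ Nv) (hq : q ∉ Nv) (ha : a ∉ Nv)
  (zn zr : (α → Bool) → α → Bool)
  (hzn : ∀ z l, inN l → zn z l = z l) (hzn0 : ∀ z l, ¬ inN l → zn z l = false)
  (hzr : ∀ z l, ¬ inN l → zr z l = z l) (hzr0 : ∀ z l, inN l → zr z l = false)
  (Rr : (α → Bool) → Bool → V → V → Prop)
  (hRr : ∀ z e u v, Rr z e u v ↔
    ((openGraph (labelledOpen ends (zr z))).Reachable u v ∨
      (e = true ∧ (((openGraph (labelledOpen ends (zr z))).Reachable u p ∧ (openGraph (labelledOpen ends (zr z))).Reachable q v) ∨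
        ((openGraph (labelledOpen ends (zr z))).Reachable u q ∧ (openGraph (labelledOpen ends (zr z))).Reachable p v)))))
  (Fl : (α → Bool) → Bool → α → Bool)
  (hFl1 : ∀ z e l, ¬ inN l → (∃ v ∈ ends l, Rr z e a v) → Fl z e l = !z l)
  (hFl2 : ∀ z e l, ¬ inN l → ¬ (∃ v ∈ ends l, Rr z e a v) → Fl z e l = z l)
  (hFl0 : ∀ z e l, inN l → Fl z e l = false)
  (Fn : (α → Bool) → Bool → Bool → α → Bool)
  (hFn1 : ∀ z πp πq l, inN l →
    ((πp = true ∧ ∃ v ∈ ends l, (openGraph (labelledOpen ends (zn z))).Reachable p v) ∨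
      (πq = true ∧ ∃ v ∈ ends l, (openGraph (labelledOpen ends (zn z))).Reachable q v)) → Fn z πp πq l = !z l)
  (hFn2 : ∀ z πp πq l, inN l →
    ¬ ((πp = true ∧ ∃ v ∈ ends l, (openGraph (labelledOpen ends (zn z))).Reachable p v) ∨
      (πq = true ∧ ∃ v ∈ ends l, (openGraph (labelledOpen ends (zn z))).Reachable q v)) → Fn z πp πq l = z l)
  (hFn0 : ∀ z πp πq l, ¬ inN l → Fn z πp πq l = false)

/-! ### 1. Connections outside the interior, with the true value of the virtual edge -/

include hN1 hN2 hzn hzn0 hzr hzr0 hRr in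
/-- With the true virtual edge `e` (`R (zn z) p q ↔ e`), connections of `z` between vertices outside `Nv` are `Rr z e`. [this work] -/
theorem reachable_iff_Rr (z : α → Bool) (e : Bool) (he : (openGraph (labelledOpen ends (zn z))).Reachable p q ↔ e = true)
    {u v : V} (hu : u ∉ Nv) (hv : v ∉ Nv) :
    (openGraph (labelledOpen ends z)).Reachable u v ↔ Rr z e u v := by
  rw [hRr, reachable_twoPort_iff ends p q Nv inN hN1 hN2 (hzn z) (hzn0 z) (hzr z) (hzr0 z) hu hv, he]

/-! ### 2. The flat, part by part -/

include hN1 hN2 hp hq ha hzn hzn0 hzr hzr0 hRr hFl1 hFl2 hFn1 hFn2 in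
/-- **The parts of the flat.**  If `e, πp, πq` are the true values for `z`, then `♭ₐz` agrees with the network flip `Fn z πp πq` on the network labels
and with the rest flat `Fl z e` on the rest labels. [this work] -/
theorem flat_eq_parts (z : α → Bool) (e πp πq : Bool)
    (he : (openGraph (labelledOpen ends (zn z))).Reachable p q ↔ e = true)
    (hπp : Rr z e a p ↔ πp = true) (hπq : Rr z e a q ↔ πq = true) (l : α) :
    (inN l → clusterFlip ends a (fun x => !z x) l = Fn z πp πq l) ∧
    (¬ inN l → clusterFlip ends a (fun x => !z x) l = Fl z e l) := by
  classical
  have hRp : (openGraph (labelledOpen ends z)).Reachable a p ↔ πp = true :=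
    (reachable_iff_Rr ends p q Nv inN hN1 hN2 zn zr hzn hzn0 hzr hzr0 Rr hRr z e he ha hp).trans hπp
  have hRq : (openGraph (labelledOpen ends z)).Reachable a q ↔ πq = true :=
    (reachable_iff_Rr ends p q Nv inN hN1 hN2 zn zr hzn hzn0 hzr hzr0 Rr hRr z e he ha hq).trans hπq
  -- the condition of `qtouch_net_iff` versus the condition of `Fn`
  have hcond : ∀ l, ((∃ t, (t = p ∨ t = q) ∧ (openGraph (labelledOpen ends z)).Reachable a t ∧
        ∃ v ∈ ends l, (openGraph (labelledOpen ends (zn z))).Reachable t v) ↔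
      ((πp = true ∧ ∃ v ∈ ends l, (openGraph (labelledOpen ends (zn z))).Reachable p v) ∨
        (πq = true ∧ ∃ v ∈ ends l, (openGraph (labelledOpen ends (zn z))).Reachable q v))) := by
    intro l
    constructor
    · rintro ⟨t, ht, hat, hv⟩
      rcases ht with rfl | rfl
      · exact Or.inl ⟨hRp.1 hat, hv⟩
      · exact Or.inr ⟨hRq.1 hat, hv⟩
    · rintro (⟨h1, hv⟩ | ⟨h1, hv⟩)
      · exact ⟨p, Or.inl rfl, hRp.2 h1, hv⟩
      · exact ⟨q, Or.inr rfl, hRq.2 h1, hv⟩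
  constructor
  · intro hl
    by_cases h : (πp = true ∧ ∃ v ∈ ends l, (openGraph (labelledOpen ends (zn z))).Reachable p v) ∨
        (πq = true ∧ ∃ v ∈ ends l, (openGraph (labelledOpen ends (zn z))).Reachable q v)
    · rw [hFn1 z πp πq l hl h,
        flat_apply_net_of ends p q Nv inN hN1 hN2 (hzn z) (hzn0 z) (hzr z) ha hl ((hcond l).2 h)]
    · rw [hFn2 z πp πq l hl h,
        flat_apply_net_of_not ends p q Nv inN hN1 hN2 (hzn z) (hzn0 z) (hzr z) ha hl (fun h' => h ((hcond l).1 h'))]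
  · intro hl
    have hv : ∀ v ∈ ends l, ((openGraph (labelledOpen ends z)).Reachable a v ↔ Rr z e a v) :=
      fun v hv => reachable_iff_Rr ends p q Nv inN hN1 hN2 zn zr hzn hzn0 hzr hzr0 Rr hRr z e he ha (hN2 l hl v hv)
    have hq' : QTouch ends a (fun x => !z x) l ↔ ∃ v ∈ ends l, Rr z e a v := by
      rw [qtouch_compl_iff]
      constructor
      · rintro ⟨v, hv', hr⟩; exact ⟨v, hv', (hv v hv').1 hr⟩
      · rintro ⟨v, hv', hr⟩; exact ⟨v, hv', (hv v hv').2 hr⟩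
    by_cases h : ∃ v ∈ ends l, Rr z e a v
    · rw [hFl1 z e l hl h, clusterFlip_of_qtouch ends a _ (hq'.2 h)]
    · rw [hFl2 z e l hl h, clusterFlip_of_not_qtouch ends a _ (fun h' => h (hq'.1 h')), Bool.not_not]

include hN1 hN2 hp hq ha hzn hzn0 hzr hzr0 hRr hFl1 hFl2 hFl0 hFn1 hFn2 hFn0 in
/-- **THE MASTER POINTWISE LEMMA.**  Let `e, πp, πq, e'` be the true values for `z` of: the virtual edge before the flat, the port pattern of the
apex cluster, and the virtual edge after the flat (`R (Fn z πp πq) p q ↔ e'`).  Then for terminals `s, c ∉ Nv`: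
`bad(z) = [(a ↮ s ∧ a ↮ c ∧ s ↮ c in z) ∧ s ↔ c in ♭ₐz]` holds iff the REST event
`¬Rr z e a s ∧ ¬Rr z e a c ∧ ¬Rr z e s c ∧ (s ↔ c in Fl z e with the virtual edge iff e')` holds. [this work] -/
theorem bad_iff_restBad (z : α → Bool) (e πp πq e' : Bool) {s c : V} (hs : s ∉ Nv) (hc : c ∉ Nv)
    (he : (openGraph (labelledOpen ends (zn z))).Reachable p q ↔ e = true)
    (hπp : Rr z e a p ↔ πp = true) (hπq : Rr z e a q ↔ πq = true)
    (he' : (openGraph (labelledOpen ends (Fn z πp πq))).Reachable p q ↔ e' = true) :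
    ((¬ (openGraph (labelledOpen ends z)).Reachable a s ∧ ¬ (openGraph (labelledOpen ends z)).Reachable a c ∧
        ¬ (openGraph (labelledOpen ends z)).Reachable s c) ∧
      (openGraph (labelledOpen ends (clusterFlip ends a fun x => !z x))).Reachable s c) ↔
    ((¬ Rr z e a s ∧ ¬ Rr z e a c ∧ ¬ Rr z e s c) ∧
      ((openGraph (labelledOpen ends (Fl z e))).Reachable s c ∨
        (e' = true ∧ (((openGraph (labelledOpen ends (Fl z e))).Reachable s p ∧ (openGraph (labelledOpen ends (Fl z e))).Reachable q c) ∨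
          ((openGraph (labelledOpen ends (Fl z e))).Reachable s q ∧ (openGraph (labelledOpen ends (Fl z e))).Reachable p c))))) := by
  have hR := fun {u v : V} (hu : u ∉ Nv) (hv : v ∉ Nv) =>
    reachable_iff_Rr ends p q Nv inN hN1 hN2 zn zr hzn hzn0 hzr hzr0 Rr hRr z e he hu hv
  -- the parts of the flat `w = ♭ₐz`
  have hparts := flat_eq_parts ends p q a Nv inN hN1 hN2 hp hq ha zn zr hzn hzn0 hzr hzr0 Rr hRr Fl hFl1 hFl2 Fn hFn1 hFn2 z e πp πq he hπp hπq
  have hw := reachable_twoPort_iff ends p q Nv inN hN1 hN2 (z := clusterFlip ends a fun x => !z x) (zn := Fn z πp πq) (zr := Fl z e)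
    (fun l hl => ((hparts l).1 hl).symm) (fun l hl => hFn0 z πp πq l hl)
    (fun l hl => ((hparts l).2 hl).symm) (fun l hl => hFl0 z e l hl) hs hc
  rw [hR ha hs, hR ha hc, hR hs hc, hw, he']

include hN1 hN2 ha hzn hzn0 hzr hzr0 hRr in
/-- The type `P1 = {a ↔ s, a ↮ c}` (and `P2`, exchanging `s, c`) is the rest event with the true virtual edge `e`. [this work] -/
theorem sa_iff_rest (z : α → Bool) (e : Bool) {s c : V} (hs : s ∉ Nv) (hc : c ∉ Nv)
    (he : (openGraph (labelledOpen ends (zn z))).Reachable p q ↔ e = true) :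
    ((openGraph (labelledOpen ends z)).Reachable a s ∧ ¬ (openGraph (labelledOpen ends z)).Reachable a c) ↔
    (Rr z e a s ∧ ¬ Rr z e a c) := by
  rw [reachable_iff_Rr ends p q Nv inN hN1 hN2 zn zr hzn hzn0 hzr hzr0 Rr hRr z e he ha hs,
    reachable_iff_Rr ends p q Nv inN hN1 hN2 zn zr hzn hzn0 hzr hzr0 Rr hRr z e he ha hc]

end Substitution

end Summit.CriticalPhenomena.PercolationContinuityZ3.Theorems.ProductFormFibre
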